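import Summits.NavierStokesRegularity.NavierStokesRegularity.Theorems.ExtremiserTransienceTwoThirdsLayerIntegral
import Summits.NavierStokesRegularity.NavierStokesRegularity.Theorems.ExtremiserTransienceTwoThirdsGaugePointwise
import Summits.NavierStokesRegularity.NavierStokesRegularity.Theorems.ExtremiserTransienceTwoThirdsDefs
import HarnessLib

/-!
# Route `ExtremiserTransience`, crux `NearExtremalTransiencePerFlow` (stmt-NavierStokesRegularity-26567), LINE g10-1 «two_thirds»
# (ns-idea-10 g10), stub S2 `FirstOrderIdentity`: the REMAINDER TERM is `O(1/ρ)·(1 + bulk)` (`R = ρ⁸`, `ℓ = ρ⁷`)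

Helper file for S2 (`--supports stmt-NavierStokesRegularity-26567`).  With the scale parameter `ρ ≥ 2`, radius `R = ρ⁸`, layer width
`ℓ = ρ⁷ = R^{7/8}`, the truncated Biot–Savart gauge `ψ = K ∗ (ζV)` (`ζ = ballCutoff c R`) and a thin-shell weight `χ` with
`|χ| ≤ 1_{B(c,R+ℓ)}`, `tsupport χ ⊆ B(c,3R/2)`, `‖Dχ‖ ≤ (K₁/ℓ)·1_Λ`, `‖D²χ‖ ≤ (2K₂/ℓ²)·1_Λ` (`Λ = B(c,R+ℓ) ∖ B(c,R)`), the remainder term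
of the reduction identity obeys

  `|a₁(χ·(V − curl ψ))| ≤ C·(1 + Z_{B(c,R+ℓ)} + (W_{B(c,R+ℓ)} − W_{B(c,R)}))/ρ`

(`remainder_bound`) with `C` depending only on `A₁, K₁, K₂, C₀, A_E` — from `abs_a1_smul_le_of_curl_eq_zero` (curl-free remainder,
`…TwoThirdsRemainderCurlFree`), the far-field sizes `‖G‖ ≲ R⁻¹`, `‖DG‖ ≲ R⁻²` (`gauge_pointwise`), and weighted AM–GM on the layer
(`∫_Λ ‖ω‖ ≤ (u·vol Λ + Z_Λ/u)/2` with `u = ρ⁻¹²`).  Also the layer-volume and weighted-mean lemmas used again by the layer estimate.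

HONEST FRAMING: bookkeeping; nothing about Navier–Stokes regularity or blow-up is proved; S2, the crux ⟨26567⟩ and NS regularity are
OPEN; no summit is proved by a line. [folklore]
-/

noncomputable section

open scoped Topology InnerProductSpace RealInnerProductSpace ENNReal ContDiff
open MeasureTheory Filter Set Metric
open Literature.Analysis.FluidPDE
open Summit.NavierStokesRegularity.NavierStokesRegularity.Theorems.DepletionLadder.KStar.HalfSpace
open Summit.NavierStokesRegularity.NavierStokesRegularity.Theorems.DepletionLadder
open Summit.NavierStokesRegularity.NavierStokesRegularity.Theorems.NearExtremalTransiencePerFlow.LocalMaximiser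

namespace Summit.NavierStokesRegularity.NavierStokesRegularity.Theorems.NearExtremalTransiencePerFlow.TwoThirds

-- the summit's namespace repeats the problem name by convention (D-0017)
set_option linter.dupNamespace false

variable {V : E3 → E3}

/-! ## Layer volume and weighted means -/

/-- `vol B(x,r) = (4π/3) r³` in `ℝ³` (real-valued). [folklore] -/
theorem volume_real_ball_eq_pi (x : E3) {r : ℝ} (hr : 0 ≤ r) : volume.real (ball x r) = r ^ 3 * (Real.pi * 4 / 3) := by
  rw [measureReal_def, EuclideanSpace.volume_ball_fin_three, ENNReal.toReal_mul, ← ENNReal.ofReal_pow hr,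
    ENNReal.toReal_ofReal (by positivity), ENNReal.toReal_ofReal (by positivity)]

/-- The layer `B(c,R+ℓ) ∖ B(c,R)` (`0 ≤ ℓ ≤ R`) has volume at most `(32π/3)R³`. [folklore] -/
theorem volume_real_layer_le (c : E3) {R ℓ : ℝ} (hR : 0 ≤ R) (hℓR : ℓ ≤ R) :
    volume.real (ball c (R + ℓ) \ ball c R) ≤ 32 * Real.pi / 3 * R ^ 3 := by
  calc volume.real (ball c (R + ℓ) \ ball c R) ≤ volume.real (ball c (2 * R)) :=
        measureReal_mono (Set.sdiff_subset.trans (ball_subset_ball (by linarith))) measure_ball_lt_top.ne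
    _ = (2 * R) ^ 3 * (Real.pi * 4 / 3) := volume_real_ball_eq_pi c (by positivity)
    _ = 32 * Real.pi / 3 * R ^ 3 := by ring

/-- **Weighted mean on a bounded set**: `∫_Λ f ≤ (u·vol Λ + ∫_Λ f²/u)/2` for continuous `f` and `u > 0`. [folklore] -/
theorem setIntegral_le_weighted {f : E3 → ℝ} (hf : Continuous f) {Λ : Set E3} (hΛm : MeasurableSet Λ) (hΛb : Bornology.IsBounded Λ)
    {u : ℝ} (hu : 0 < u) :
    ∫ x in Λ, f x ≤ (u * volume.real Λ + (∫ x in Λ, f x ^ 2) / u) / 2 := by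
  have hvol : volume Λ < ⊤ := hΛb.measure_lt_top
  have i1 : IntegrableOn f Λ := integrableOn_of_continuous_isBounded hf hΛb
  have i2 : IntegrableOn (fun x => f x ^ 2) Λ := integrableOn_of_continuous_isBounded (hf.pow 2) hΛb
  have i3 : IntegrableOn (fun x => (u * 1 ^ 2 + f x ^ 2 / u) / 2) Λ :=
    (((integrableOn_const hvol.ne).add (i2.div_const u)).div_const 2)
  calc ∫ x in Λ, f x ≤ ∫ x in Λ, (u * 1 ^ 2 + f x ^ 2 / u) / 2 := by
        refine setIntegral_mono_on i1 i3 hΛm fun x _ => ?_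
        have h := mul_le_weighted_sq (p := (1 : ℝ)) (q := f x) hu
        rwa [one_mul] at h
    _ = (u * volume.real Λ + (∫ x in Λ, f x ^ 2) / u) / 2 := by
        have hc : IntegrableOn (fun _ : E3 => u * (1 : ℝ) ^ 2) Λ := integrableOn_const hvol.ne
        rw [integral_div, integral_add hc (i2.div_const u), integral_div, setIntegral_const, smul_eq_mul]
        ring

/-- The layer enstrophy is a difference of ball enstrophies (and is at most the larger ball's). [folklore] -/
theorem setIntegral_layer_zd_eq (hVs : ContDiff ℝ (⊤ : ℕ∞) V) (c : E3) {R ℓ : ℝ} (hℓ : 0 ≤ ℓ) :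
    ∫ x in ball c (R + ℓ) \ ball c R, zd V x = Zb V c (R + ℓ) - Zb V c R ∧
    ∫ x in ball c (R + ℓ) \ ball c R, zd V x ≤ Zb V c (R + ℓ) := by
  have hsub : ball c R ⊆ ball c (R + ℓ) := ball_subset_ball (by linarith)
  have i1 : IntegrableOn (zd V) (ball c (R + ℓ)) := integrableOn_ball_of_continuous (continuous_zd' hVs) c (R + ℓ)
  refine ⟨by unfold Zb; exact setIntegral_sdiff measurableSet_ball i1 hsub, ?_⟩
  unfold Zb
  exact setIntegral_mono_set i1 (Eventually.of_forall fun x => by unfold zd; positivity) (Eventually.of_forall Set.sdiff_subset)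

/-- The layer palinstrophy is a difference of ball palinstrophies. [folklore] -/
theorem setIntegral_layer_wd_eq (hVs : ContDiff ℝ (⊤ : ℕ∞) V) (c : E3) {R ℓ : ℝ} (hℓ : 0 ≤ ℓ) :
    ∫ x in ball c (R + ℓ) \ ball c R, wd V x = Wb V c (R + ℓ) - Wb V c R := by
  have hsub : ball c R ⊆ ball c (R + ℓ) := ball_subset_ball (by linarith)
  have i1 : IntegrableOn (wd V) (ball c (R + ℓ)) := integrableOn_ball_of_continuous (continuous_wd' hVs) c (R + ℓ)
  unfold Wb
  exact setIntegral_sdiff measurableSet_ball i1 hsub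

/-! ## The remainder bound -/

/-- The arithmetic of the remainder bound: with `k₁ = K₁/ρ⁷`, `k₂ = 2K₂/ρ¹⁴`, `g₀ = P/(πρ⁸)`, `g₁ = 8P/(πρ¹⁶)` (`R = ρ⁸`) and the
weighted-mean bounds `∫_Λ‖ω‖ ≤ ρ¹²(32π/3 + Z_S)/2`, `∫_Λ√wd ≤ ρ¹²(32π/3 + W_Λ)/2`, `∫_Λ zd ≤ Z_S`, the four terms of
`abs_a1_smul_le_of_curl_eq_zero` add up to `O(1/ρ)·(1 + Z_S + W_Λ)`. [folklore] -/
theorem remainder_arith {ρ P K₁ K₂ A₁ c IΩ IZ IW ZS WΛ : ℝ} (hρ : 2 ≤ ρ) (hP : 0 ≤ P) (hK₁ : 0 ≤ K₁) (hK₂ : 0 ≤ K₂)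
    (hA₁ : 0 ≤ A₁) (hc : 0 ≤ c) (hZS : 0 ≤ ZS) (hW : 0 ≤ WΛ) (hIZ0 : 0 ≤ IZ) (hIW0 : 0 ≤ IW)
    (hIΩ : IΩ ≤ ρ ^ 12 * (32 * Real.pi / 3 + ZS) / 2) (hIW : IW ≤ ρ ^ 12 * (32 * Real.pi / 3 + WΛ) / 2) (hIZ : IZ ≤ ZS) :
    (2 * A₁ + kStar) * c * (K₁ / ρ ^ 7 * ((Real.pi * (ρ ^ 8) ^ 2)⁻¹ * (P * ρ ^ 8))) * IΩ +
      ((8 / (Real.pi * (ρ ^ 8) ^ 3) * (P * ρ ^ 8)) * ZS + K₁ / ρ ^ 7 * ((Real.pi * (ρ ^ 8) ^ 2)⁻¹ * (P * ρ ^ 8)) * IZ) +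
      3 * kStar * c * (2 * K₂ / (ρ ^ 7) ^ 2 * ((Real.pi * (ρ ^ 8) ^ 2)⁻¹ * (P * ρ ^ 8)) +
        K₁ / ρ ^ 7 * (8 / (Real.pi * (ρ ^ 8) ^ 3) * (P * ρ ^ 8))) * IW ≤
      ((2 * A₁ + kStar) * c * (K₁ * P / Real.pi) * (32 * Real.pi / 3 + 1) / 2 + 8 * P / Real.pi + K₁ * P / Real.pi +
        3 * kStar * c * ((2 * K₂ + 8 * K₁) * P / Real.pi) * (32 * Real.pi / 3 + 1) / 2) * (1 + ZS + WΛ) / ρ := by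
  have hK : 0 < kStar := kStar_pos
  have hρ0 : 0 < ρ := by linarith
  have hρ1 : 1 ≤ ρ := by linarith
  have hπ : 0 < Real.pi := Real.pi_pos
  -- the sizes as powers of `ρ`
  have e1 : K₁ / ρ ^ 7 * ((Real.pi * (ρ ^ 8) ^ 2)⁻¹ * (P * ρ ^ 8)) = K₁ * P / Real.pi * (ρ ^ 15)⁻¹ := by
    field_simp
  have e2 : 8 / (Real.pi * (ρ ^ 8) ^ 3) * (P * ρ ^ 8) = 8 * P / Real.pi * (ρ ^ 16)⁻¹ := by
    field_simp
  have e3 : 2 * K₂ / (ρ ^ 7) ^ 2 * ((Real.pi * (ρ ^ 8) ^ 2)⁻¹ * (P * ρ ^ 8)) + K₁ / ρ ^ 7 * (8 / (Real.pi * (ρ ^ 8) ^ 3) * (P * ρ ^ 8)) =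
      2 * K₂ * P / Real.pi * (ρ ^ 22)⁻¹ + 8 * K₁ * P / Real.pi * (ρ ^ 23)⁻¹ := by
    field_simp
  rw [e3, e1, e2]
  -- powers of `ρ`
  have hp : ∀ {m n : ℕ}, m ≤ n → (ρ ^ n)⁻¹ ≤ (ρ ^ m)⁻¹ := fun hmn =>
    inv_anti₀ (by positivity) (pow_le_pow_right₀ hρ1 hmn)
  have h3a : (ρ ^ 3)⁻¹ ≤ ρ⁻¹ := by simpa using hp (m := 1) (n := 3) (by norm_num)
  have h16 : (ρ ^ 16)⁻¹ ≤ ρ⁻¹ := by simpa using hp (m := 1) (n := 16) (by norm_num)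
  have h15 : (ρ ^ 15)⁻¹ ≤ ρ⁻¹ := by simpa using hp (m := 1) (n := 15) (by norm_num)
  have h10 : (ρ ^ 10)⁻¹ ≤ ρ⁻¹ := by simpa using hp (m := 1) (n := 10) (by norm_num)
  have h23 : (ρ ^ 23)⁻¹ ≤ (ρ ^ 22)⁻¹ := hp (by norm_num)
  have hρi : 0 ≤ ρ⁻¹ := by positivity
  have hB1 : 32 * Real.pi / 3 + ZS ≤ (32 * Real.pi / 3 + 1) * (1 + ZS + WΛ) := by nlinarith
  have hB2 : 32 * Real.pi / 3 + WΛ ≤ (32 * Real.pi / 3 + 1) * (1 + ZS + WΛ) := by nlinarith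
  -- T1
  set X1 : ℝ := (2 * A₁ + kStar) * c * (K₁ * P / Real.pi) with hX1
  have hX10 : 0 ≤ X1 := by positivity
  have T1 : (2 * A₁ + kStar) * c * (K₁ * P / Real.pi * (ρ ^ 15)⁻¹) * IΩ ≤ X1 * (32 * Real.pi / 3 + 1) / 2 * (1 + ZS + WΛ) * ρ⁻¹ := by
    have s0 : (2 * A₁ + kStar) * c * (K₁ * P / Real.pi * (ρ ^ 15)⁻¹) * IΩ ≤
        (2 * A₁ + kStar) * c * (K₁ * P / Real.pi * (ρ ^ 15)⁻¹) * (ρ ^ 12 * (32 * Real.pi / 3 + ZS) / 2) :=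
      mul_le_mul_of_nonneg_left hIΩ (by positivity)
    have s0e : (2 * A₁ + kStar) * c * (K₁ * P / Real.pi * (ρ ^ 15)⁻¹) * (ρ ^ 12 * (32 * Real.pi / 3 + ZS) / 2) =
        X1 * (32 * Real.pi / 3 + ZS) / 2 * (ρ ^ 3)⁻¹ := by
      rw [hX1]; field_simp
    have s1 : X1 * (32 * Real.pi / 3 + ZS) / 2 * (ρ ^ 3)⁻¹ ≤ X1 * (32 * Real.pi / 3 + ZS) / 2 * ρ⁻¹ :=
      mul_le_mul_of_nonneg_left h3a (by positivity)
    have s2 : X1 * (32 * Real.pi / 3 + ZS) / 2 * ρ⁻¹ ≤ X1 * ((32 * Real.pi / 3 + 1) * (1 + ZS + WΛ)) / 2 * ρ⁻¹ :=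
      mul_le_mul_of_nonneg_right (div_le_div_of_nonneg_right (mul_le_mul_of_nonneg_left hB1 hX10) (by norm_num)) hρi
    have s3 : X1 * ((32 * Real.pi / 3 + 1) * (1 + ZS + WΛ)) / 2 * ρ⁻¹ = X1 * (32 * Real.pi / 3 + 1) / 2 * (1 + ZS + WΛ) * ρ⁻¹ := by
      ring
    linarith only [s0, s0e, s1, s2, s3]
  -- T2
  have T2 : 8 * P / Real.pi * (ρ ^ 16)⁻¹ * ZS ≤ 8 * P / Real.pi * (1 + ZS + WΛ) * ρ⁻¹ := by
    have h5 : 0 ≤ 8 * P / Real.pi := by positivity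
    have s1 : 8 * P / Real.pi * (ρ ^ 16)⁻¹ * ZS ≤ 8 * P / Real.pi * ρ⁻¹ * ZS :=
      mul_le_mul_of_nonneg_right (mul_le_mul_of_nonneg_left h16 h5) hZS
    have h4 : ZS ≤ 1 + ZS + WΛ := by linarith
    have s2 : 8 * P / Real.pi * ρ⁻¹ * ZS ≤ 8 * P / Real.pi * ρ⁻¹ * (1 + ZS + WΛ) := mul_le_mul_of_nonneg_left h4 (by positivity)
    linarith only [s1, s2]
  -- T3
  have T3 : K₁ * P / Real.pi * (ρ ^ 15)⁻¹ * IZ ≤ K₁ * P / Real.pi * (1 + ZS + WΛ) * ρ⁻¹ := by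
    have h5 : 0 ≤ K₁ * P / Real.pi := by positivity
    have s1 : K₁ * P / Real.pi * (ρ ^ 15)⁻¹ * IZ ≤ K₁ * P / Real.pi * ρ⁻¹ * IZ :=
      mul_le_mul_of_nonneg_right (mul_le_mul_of_nonneg_left h15 h5) hIZ0
    have h4 : IZ ≤ 1 + ZS + WΛ := by linarith
    have s2 : K₁ * P / Real.pi * ρ⁻¹ * IZ ≤ K₁ * P / Real.pi * ρ⁻¹ * (1 + ZS + WΛ) := mul_le_mul_of_nonneg_left h4 (by positivity)
    linarith only [s1, s2]
  -- T4
  set X4 : ℝ := 3 * kStar * c * ((2 * K₂ + 8 * K₁) * P / Real.pi) with hX4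
  have hX40 : 0 ≤ X4 := by positivity
  have T4 : 3 * kStar * c * (2 * K₂ * P / Real.pi * (ρ ^ 22)⁻¹ + 8 * K₁ * P / Real.pi * (ρ ^ 23)⁻¹) * IW ≤
      X4 * (32 * Real.pi / 3 + 1) / 2 * (1 + ZS + WΛ) * ρ⁻¹ := by
    have h22 : 2 * K₂ * P / Real.pi * (ρ ^ 22)⁻¹ + 8 * K₁ * P / Real.pi * (ρ ^ 23)⁻¹ ≤ (2 * K₂ + 8 * K₁) * P / Real.pi * (ρ ^ 22)⁻¹ := by
      have h0 : 0 ≤ 8 * K₁ * P / Real.pi := by positivity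
      have h6 := mul_le_mul_of_nonneg_left h23 h0
      have e4 : (2 * K₂ + 8 * K₁) * P / Real.pi * (ρ ^ 22)⁻¹ =
          2 * K₂ * P / Real.pi * (ρ ^ 22)⁻¹ + 8 * K₁ * P / Real.pi * (ρ ^ 22)⁻¹ := by ring
      linarith only [h6, e4]
    have s0 : 3 * kStar * c * (2 * K₂ * P / Real.pi * (ρ ^ 22)⁻¹ + 8 * K₁ * P / Real.pi * (ρ ^ 23)⁻¹) * IW ≤
        X4 * (ρ ^ 22)⁻¹ * (ρ ^ 12 * (32 * Real.pi / 3 + WΛ) / 2) := by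
      have h7 : 3 * kStar * c * (2 * K₂ * P / Real.pi * (ρ ^ 22)⁻¹ + 8 * K₁ * P / Real.pi * (ρ ^ 23)⁻¹) ≤ X4 * (ρ ^ 22)⁻¹ := by
        rw [hX4, mul_assoc (3 * kStar * c) ((2 * K₂ + 8 * K₁) * P / Real.pi)]
        exact mul_le_mul_of_nonneg_left h22 (by positivity)
      exact mul_le_mul h7 hIW hIW0 (by positivity)
    have s0e : X4 * (ρ ^ 22)⁻¹ * (ρ ^ 12 * (32 * Real.pi / 3 + WΛ) / 2) = X4 * (32 * Real.pi / 3 + WΛ) / 2 * (ρ ^ 10)⁻¹ := by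
      field_simp
    have s1 : X4 * (32 * Real.pi / 3 + WΛ) / 2 * (ρ ^ 10)⁻¹ ≤ X4 * (32 * Real.pi / 3 + WΛ) / 2 * ρ⁻¹ :=
      mul_le_mul_of_nonneg_left h10 (by positivity)
    have s2 : X4 * (32 * Real.pi / 3 + WΛ) / 2 * ρ⁻¹ ≤ X4 * ((32 * Real.pi / 3 + 1) * (1 + ZS + WΛ)) / 2 * ρ⁻¹ :=
      mul_le_mul_of_nonneg_right (div_le_div_of_nonneg_right (mul_le_mul_of_nonneg_left hB2 hX40) (by norm_num)) hρi
    have s3 : X4 * ((32 * Real.pi / 3 + 1) * (1 + ZS + WΛ)) / 2 * ρ⁻¹ = X4 * (32 * Real.pi / 3 + 1) / 2 * (1 + ZS + WΛ) * ρ⁻¹ := by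
      ring
    linarith only [s0, s0e, s1, s2, s3]
  rw [div_eq_mul_inv _ ρ, hX1] at *
  rw [hX4] at T4
  linarith only [T1, T2, T3, T4]

/-- **THE REMAINDER TERM IS `O(1/ρ)(1 + bulk)`** (see the module docstring). [folklore] -/
theorem remainder_bound {A₁ K₁ K₂ C₀ A_E : ℝ} (hA₁ : 0 ≤ A₁) (hK₁ : 0 ≤ K₁) (hK₂ : 0 ≤ K₂) (hC₀0 : 0 ≤ C₀) (hAE : 0 ≤ A_E)
    {V : E3 → E3} {c : E3} {ρ : ℝ} {χ : E3 → ℝ}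
    (hVs : ContDiff ℝ (⊤ : ℕ∞) V) (hdiv : VectorCalculus.IsDivFree V) (hV1 : ∀ x, ‖V x‖ ≤ 1) (hgr : HasLinearGrowth A_E V)
    (hA : ∀ x, ‖fderiv ℝ V x‖ ≤ A₁) (hρ : 2 ≤ ρ) (hC₀ : ∀ y, ‖fderiv ℝ (ballCutoff c (ρ ^ 8)) y‖ ≤ C₀ / ρ ^ 8)
    (hχ : ContDiff ℝ (⊤ : ℕ∞) χ) (hχT : tsupport χ ⊆ ball c (3 / 2 * ρ ^ 8))
    (hχS : ∀ x, |χ x| ≤ (ball c (ρ ^ 8 + ρ ^ 7)).indicator (fun _ => (1 : ℝ)) x)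
    (hk₁ : ∀ x, ‖fderiv ℝ χ x‖ ≤ K₁ / ρ ^ 7 * (ball c (ρ ^ 8 + ρ ^ 7) \ ball c (ρ ^ 8)).indicator (fun _ => (1 : ℝ)) x)
    (hk₂ : ∀ x, ‖iteratedFDeriv ℝ 2 χ x‖ ≤
      2 * K₂ / (ρ ^ 7) ^ 2 * (ball c (ρ ^ 8 + ρ ^ 7) \ ball c (ρ ^ 8)).indicator (fun _ => (1 : ℝ)) x) :
    |a1 kStar 1 V (fun y => χ y • (V y - curl (biotSavart fun y => ballCutoff c (ρ ^ 8) y • V y) y))| ≤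
      ((2 * A₁ + kStar) * ‖curlCLM‖ * (K₁ * (8 * C₀ * (A_E + 4 * Real.pi / 3)) / Real.pi) * (32 * Real.pi / 3 + 1) / 2 +
        8 * (8 * C₀ * (A_E + 4 * Real.pi / 3)) / Real.pi + K₁ * (8 * C₀ * (A_E + 4 * Real.pi / 3)) / Real.pi +
        3 * kStar * ‖curlCLM‖ * ((2 * K₂ + 8 * K₁) * (8 * C₀ * (A_E + 4 * Real.pi / 3)) / Real.pi) * (32 * Real.pi / 3 + 1) / 2) *
      (1 + Zb V c (ρ ^ 8 + ρ ^ 7) + (Wb V c (ρ ^ 8 + ρ ^ 7) - Wb V c (ρ ^ 8))) / ρ := by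
  have hρ0 : 0 < ρ := by linarith
  have hρ1 : 1 ≤ ρ := by linarith
  have hR0 : 0 < ρ ^ 8 := by positivity
  have hℓ0 : 0 < ρ ^ 7 := by positivity
  have hℓR : ρ ^ 7 ≤ ρ ^ 8 := pow_le_pow_right₀ hρ1 (by norm_num)
  -- the gauge package
  obtain ⟨hψs, hGs, hcurl, hg₀, hg₁, -⟩ := gauge_pointwise (c := c) hVs hdiv hV1 hgr hAE hR0 hC₀0 hC₀
  have hP0 : 0 ≤ 8 * C₀ * (A_E + 4 * Real.pi / 3) := by positivity
  -- the curl-free remainder estimate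
  have hTsub : ball c (3 / 2 * ρ ^ 8) ⊆ ball c (2 * ρ ^ 8) := ball_subset_ball (by linarith)
  have hmain := abs_a1_smul_le_of_curl_eq_zero (V := V)
    (G := fun x => V x - curl (biotSavart fun y => ballCutoff c (ρ ^ 8) y • V y) x) (χ := χ)
    (T := ball c (3 / 2 * ρ ^ 8)) (S := ball c (ρ ^ 8 + ρ ^ 7)) (L := ball c (ρ ^ 8 + ρ ^ 7) \ ball c (ρ ^ 8))
    hVs hGs hχ isOpen_ball hχT (fun y hy => hcurl y (hTsub hy))
    measurableSet_ball (measurableSet_ball.diff measurableSet_ball) isBounded_ball (isBounded_ball.subset Set.sdiff_subset)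
    (by positivity) (by positivity) hA (fun x hx => hg₀ x hx) (fun x hx => hg₁ x hx) hχS hk₁ hk₂
  refine hmain.trans ?_
  -- the weights
  have hZΛ := setIntegral_layer_zd_eq hVs c (R := ρ ^ 8) hℓ0.le
  have hWΛ := setIntegral_layer_wd_eq hVs c (R := ρ ^ 8) hℓ0.le
  have hZS0 : 0 ≤ Zb V c (ρ ^ 8 + ρ ^ 7) := Zb_nonneg V c _
  have hmeas : MeasurableSet (ball c (ρ ^ 8 + ρ ^ 7) \ ball c (ρ ^ 8)) := measurableSet_ball.diff measurableSet_ball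
  have hbdd : Bornology.IsBounded (ball c (ρ ^ 8 + ρ ^ 7) \ ball c (ρ ^ 8)) := isBounded_ball.subset Set.sdiff_subset
  have hWΛ0 : 0 ≤ Wb V c (ρ ^ 8 + ρ ^ 7) - Wb V c (ρ ^ 8) := by
    rw [← hWΛ]; exact setIntegral_nonneg hmeas fun x _ => frobeniusNormSq_nonneg _
  have hIZ0 : 0 ≤ ∫ x in ball c (ρ ^ 8 + ρ ^ 7) \ ball c (ρ ^ 8), zd V x :=
    setIntegral_nonneg hmeas fun x _ => by unfold zd; positivity
  have hIW0 : 0 ≤ ∫ x in ball c (ρ ^ 8 + ρ ^ 7) \ ball c (ρ ^ 8), Real.sqrt (wd V x) :=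
    setIntegral_nonneg hmeas fun x _ => Real.sqrt_nonneg _
  have hvol : volume.real (ball c (ρ ^ 8 + ρ ^ 7) \ ball c (ρ ^ 8)) ≤ 32 * Real.pi / 3 * (ρ ^ 8) ^ 3 :=
    volume_real_layer_le c hR0.le hℓR
  have hu : (0 : ℝ) < (ρ ^ 12)⁻¹ := by positivity
  have hvol' : (ρ ^ 12)⁻¹ * volume.real (ball c (ρ ^ 8 + ρ ^ 7) \ ball c (ρ ^ 8)) ≤ 32 * Real.pi / 3 * ρ ^ 12 := by
    have h1 := mul_le_mul_of_nonneg_left hvol hu.le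
    have e : (ρ ^ 12)⁻¹ * (32 * Real.pi / 3 * (ρ ^ 8) ^ 3) = 32 * Real.pi / 3 * ρ ^ 12 := by field_simp
    linarith only [h1, e]
  have hω : ∫ x in ball c (ρ ^ 8 + ρ ^ 7) \ ball c (ρ ^ 8), ‖curl V x‖ ≤ ρ ^ 12 * (32 * Real.pi / 3 + Zb V c (ρ ^ 8 + ρ ^ 7)) / 2 := by
    have h := setIntegral_le_weighted (f := fun x => ‖curl V x‖) (Λ := ball c (ρ ^ 8 + ρ ^ 7) \ ball c (ρ ^ 8))
      (continuous_curl (hVs.of_le (by norm_cast))).norm hmeas hbdd hu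
    have hz : (∫ x in ball c (ρ ^ 8 + ρ ^ 7) \ ball c (ρ ^ 8), ‖curl V x‖ ^ 2) ≤ Zb V c (ρ ^ 8 + ρ ^ 7) := hZΛ.2
    have e : (∫ x in ball c (ρ ^ 8 + ρ ^ 7) \ ball c (ρ ^ 8), ‖curl V x‖ ^ 2) / (ρ ^ 12)⁻¹ =
        ρ ^ 12 * ∫ x in ball c (ρ ^ 8 + ρ ^ 7) \ ball c (ρ ^ 8), ‖curl V x‖ ^ 2 := by field_simp
    rw [e] at h
    have h2 : ρ ^ 12 * (∫ x in ball c (ρ ^ 8 + ρ ^ 7) \ ball c (ρ ^ 8), ‖curl V x‖ ^ 2) ≤ ρ ^ 12 * Zb V c (ρ ^ 8 + ρ ^ 7) :=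
      mul_le_mul_of_nonneg_left hz (by positivity)
    linarith only [h, hvol', h2]
  have hsw : ∫ x in ball c (ρ ^ 8 + ρ ^ 7) \ ball c (ρ ^ 8), Real.sqrt (wd V x) ≤
      ρ ^ 12 * (32 * Real.pi / 3 + (Wb V c (ρ ^ 8 + ρ ^ 7) - Wb V c (ρ ^ 8))) / 2 := by
    have h := setIntegral_le_weighted (f := fun x => Real.sqrt (wd V x)) (Λ := ball c (ρ ^ 8 + ρ ^ 7) \ ball c (ρ ^ 8))
      (continuous_wd' hVs).sqrt hmeas hbdd hu
    have hsq : (∫ x in ball c (ρ ^ 8 + ρ ^ 7) \ ball c (ρ ^ 8), Real.sqrt (wd V x) ^ 2) = Wb V c (ρ ^ 8 + ρ ^ 7) - Wb V c (ρ ^ 8) := by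
      rw [← hWΛ]
      exact setIntegral_congr_fun hmeas fun x _ => Real.sq_sqrt (frobeniusNormSq_nonneg _)
    have e : (Wb V c (ρ ^ 8 + ρ ^ 7) - Wb V c (ρ ^ 8)) / (ρ ^ 12)⁻¹ = ρ ^ 12 * (Wb V c (ρ ^ 8 + ρ ^ 7) - Wb V c (ρ ^ 8)) := by
      field_simp
    rw [hsq, e] at h
    linarith only [h, hvol']
  exact remainder_arith hρ hP0 hK₁ hK₂ hA₁ (norm_nonneg curlCLM) hZS0 hWΛ0 hIZ0 hIW0 hω hsw hZΛ.2

end Summit.NavierStokesRegularity.NavierStokesRegularity.Theorems.NearExtremalTransiencePerFlow.TwoThirds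

end
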